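import Summits.CriticalPhenomena.PercolationContinuityZ3.Theorems.PercNearOneGluingNoHeavyLowerTailSunflowerAndrasfaiRuns
import HarnessLib

/-!
# `NoHeavyLowerTail` (crux stmt-CriticalPhenomena-4575), abstract sunflower cubic: the ANDRÁSFAI GRAPHS ARE A-SAFE, part 3a — the Interval Merging Lemma: shapes of petal rows, criteria for core and crossing rows, weights

Support file (seat `prim-ineq-prove-1` gen 42; `--supports stmt-CriticalPhenomena-4575`).  No `sorry`, no named facts, standard axioms.
Memo: run/shared/lean/prim/prim-ineq-prove-1/FINDING-BLOWUP-prove1-g42.md §7 (the theorem and its proof).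

THE PROGRAMME (files `…SunflowerAndrasfai*`).  THEOREM (memo §7; `Arc.arcGraph_safe` in `…SunflowerAndrasfaiSafe`): for every `k`
the graph core of the Andrásfai graph (`arcGraph k` on `Fin (3k+2)`: adjacent iff in no common arc of `k+1` consecutive points) is
safe for every product measure — conjecture (And) of `…SunflowerAndrasfai`; hence (…SunflowerBlowup, …BlowupHom) so is the core
of every blow-up of an Andrásfai graph and of every maximal triangle-free graph homomorphic to one.  PROOF: polarisation
(`safe_arcGraph_of_colouring_ineq`, part 1b) reduces safety to `∏_j Λ(C_j) ≤ Λ(∅)^(K-1)` for colourings of the arc-starts; this is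
proved by induction on the number of colour changes (part 4): one of two adjacent LIGHT runs `X`, `Y` (`|X|+|Y| ≤ 2k+1`, `|Y| ≤ k`,
part 2b) is recoloured with the other's colour, which does not decrease the product by FACT 1/2 (part 2a) and the INTERVAL MERGING
LEMMA `w(X)·w(Y) ≤ Λ(∅)·z(X,Y)` (part 3: an explicit weight-preserving injection `Φ : W_X × W_Y → A × Z_{XY}`).

THIS FILE.  Coordinates from an origin (`fd_coord_cases`, `coord_of_mem_arc`); the shape of the petal rows of `X = ivl o 0 (s-1)` and
`Y = ivl o s (s+t-1)` (`shape_X`, `shape_Y`); criteria `mem_Z_of_coords` (crossing rows) and `U_eq_empty_of_witnesses` (core rows);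
row weights as products (`wrow_eq_prod`) and `wrow_mul_eq_of_cnt` (pairs of rows with equal membership counts have equal weight
products).
-/

noncomputable section

namespace Summit.CriticalPhenomena.PercolationContinuityZ3.Theorems.SunflowerPartition

namespace SafeCalc

open Finset
open TwoGenCore (wmiss)

namespace Arc

variable {k : ℕ}

/-! ## The Interval Merging Lemma: coordinates, the shape of petal rows, criteria for the targets -/

section IML

variable (p : Fin (3 * k + 2) → unitInterval)

/-- Forward distance from `u` in terms of coordinates from an origin `o` (the two cases: `x` after / before `u`). -/
theorem fd_coord_cases (o u x : Fin (3 * k + 2)) :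
    (fd o u ≤ fd o x ∧ fd u x = fd o x - fd o u) ∨ (fd o x < fd o u ∧ fd u x = 3 * k + 2 - (fd o u - fd o x)) := by
  by_cases h : fd o u ≤ fd o x
  · exact Or.inl ⟨h, fd_sub h⟩
  · have hne : x ≠ u := by intro hxu; rw [hxu] at h; exact h le_rfl
    exact Or.inr ⟨not_le.1 h, fd_sub_rev (le_of_lt (not_le.1 h)) hne⟩

/-- A point of an arc whose start has coordinate `g ≤ 3k+1-k` has coordinate in `[g, g+k]` (no wrap-around). -/
theorem coord_of_mem_arc {o u x : Fin (3 * k + 2)} (hu : fd o u + k < 3 * k + 2) (hx : x ∈ arc k u) :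
    fd o u ≤ fd o x ∧ fd o x ≤ fd o u + k := by
  rw [mem_arc] at hx
  have := fd_add_fd (show fd o u + fd u x < 3 * k + 2 by omega)
  omega

/-- Shape of a petal row of `X = ivl o 0 (s-1)` (`1 ≤ s ≤ 2k+1`): coordinates `≤ s+k-1`, pairwise within `k`, some coordinate
`≤ s-1`, some coordinate `≥ k`, and the row is non-empty. [this work] -/
theorem shape_X {o : Fin (3 * k + 2)} {s : ℕ} (hs1 : 1 ≤ s) (hs2 : s ≤ 2 * k + 1) {S : Finset (Fin (3 * k + 2))}
    (hU : (U (k := k) S).Nonempty) (hUX : U (k := k) S ⊆ ivl o 0 (s - 1)) :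
    S.Nonempty ∧ (∀ x ∈ S, fd o x ≤ s + k - 1) ∧ (∀ x ∈ S, ∀ y ∈ S, fd o y ≤ fd o x + k) ∧
      (∃ x ∈ S, fd o x ≤ s - 1) ∧ (∃ x ∈ S, k ≤ fd o x) := by
  obtain ⟨u, hu⟩ := hU
  have huX := mem_ivl.1 (hUX hu)
  rw [mem_U] at hu
  have hug : fd o u + k < 3 * k + 2 := by omega
  have hco : ∀ x ∈ S, fd o u ≤ fd o x ∧ fd o x ≤ fd o u + k := fun x hx => coord_of_mem_arc hug (hu hx)
  -- non-emptiness: the start just before `o` is not in `X`, so `U S ≠ univ`, so `S ≠ ∅`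
  have hne : S.Nonempty := by
    rw [Finset.nonempty_iff_ne_empty]
    intro hS
    have : sh o (3 * k + 1) ∈ U (k := k) S := by rw [mem_U, hS]; exact empty_subset _
    have := mem_ivl.1 (hUX this)
    rw [fd_sh o (show 3 * k + 1 < 3 * k + 2 by omega)] at this
    omega
  have hspan : ∀ x ∈ S, ∀ y ∈ S, fd o y ≤ fd o x + k := by
    intro x hx y hy; have := hco x hx; have := hco y hy; omega
  refine ⟨hne, fun x hx => by have := hco x hx; omega, hspan, ?_, ?_⟩
  · -- the point of least coordinate starts an arc containing `S`
    obtain ⟨x₀, hx₀, hmin⟩ := exists_min_image S (fun x => fd o x) hne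
    refine ⟨x₀, hx₀, ?_⟩
    have : x₀ ∈ U (k := k) S := by
      rw [mem_U]; intro y hy; rw [mem_arc, fd_sub (hmin y hy)]; have := hspan x₀ hx₀ y hy; omega
    exact (mem_ivl.1 (hUX this)).2
  · by_contra hlt
    push Not at hlt
    -- all coordinates `< k`: the arc starting just before `o` contains `S`
    have hmem : sh o (3 * k + 1) ∈ U (k := k) S := by
      rw [mem_U]; intro y hy; rw [mem_arc]
      have e1 : fd o (sh o (3 * k + 1)) = 3 * k + 1 := fd_sh o (by omega)
      have hne' : y ≠ sh o (3 * k + 1) := by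
        intro h; have := hlt y hy; rw [h, e1] at this; omega
      rw [fd_sub_rev (show fd o y ≤ fd o (sh o (3 * k + 1)) by rw [e1]; have := fd_lt o y; omega) hne', e1]
      have := hlt y hy; omega
    have := mem_ivl.1 (hUX hmem)
    rw [fd_sh o (show 3 * k + 1 < 3 * k + 2 by omega)] at this
    omega

/-- Shape of a petal row of `Y = ivl o s (s+t-1)` (`1 ≤ s`, `1 ≤ t`, `s + t ≤ 2k+1`): coordinates in `[s, s+t+k-1]`, pairwise within
`k`, some coordinate `≤ s+t-1`, some `≥ s+k`, non-empty. [this work] -/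
theorem shape_Y {o : Fin (3 * k + 2)} {s t : ℕ} (hs1 : 1 ≤ s) (ht1 : 1 ≤ t) (hst : s + t ≤ 2 * k + 1)
    {T : Finset (Fin (3 * k + 2))} (hU : (U (k := k) T).Nonempty) (hUY : U (k := k) T ⊆ ivl o s (s + t - 1)) :
    T.Nonempty ∧ (∀ x ∈ T, s ≤ fd o x ∧ fd o x ≤ s + t + k - 1) ∧ (∀ x ∈ T, ∀ y ∈ T, fd o y ≤ fd o x + k) ∧
      (∃ x ∈ T, fd o x ≤ s + t - 1) ∧ (∃ x ∈ T, s + k ≤ fd o x) := by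
  obtain ⟨u, hu⟩ := hU
  have huY := mem_ivl.1 (hUY hu)
  rw [mem_U] at hu
  have hug : fd o u + k < 3 * k + 2 := by omega
  have hco : ∀ x ∈ T, fd o u ≤ fd o x ∧ fd o x ≤ fd o u + k := fun x hx => coord_of_mem_arc hug (hu hx)
  have hne : T.Nonempty := by
    rw [Finset.nonempty_iff_ne_empty]
    intro hT
    have : o ∈ U (k := k) T := by rw [mem_U, hT]; exact empty_subset _
    have := mem_ivl.1 (hUY this)
    rw [fd_self] at this
    omega
  have hspan : ∀ x ∈ T, ∀ y ∈ T, fd o y ≤ fd o x + k := by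
    intro x hx y hy; have := hco x hx; have := hco y hy; omega
  refine ⟨hne, fun x hx => by have := hco x hx; omega, hspan, ?_, ?_⟩
  · obtain ⟨x₀, hx₀, hmin⟩ := exists_min_image T (fun x => fd o x) hne
    refine ⟨x₀, hx₀, ?_⟩
    have : x₀ ∈ U (k := k) T := by
      rw [mem_U]; intro y hy; rw [mem_arc, fd_sub (hmin y hy)]; have := hspan x₀ hx₀ y hy; omega
    exact (mem_ivl.1 (hUY this)).2
  · by_contra hlt
    push Not at hlt
    -- all coordinates `≤ s+k-1`: the arc starting at coordinate `s-1` (in `X`, not in `Y`) contains `T`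
    have hmem : sh o (s - 1) ∈ U (k := k) T := by
      rw [mem_U]; intro y hy; rw [mem_arc]
      have e1 : fd o (sh o (s - 1)) = s - 1 := fd_sh o (by omega)
      rw [fd_sub (show fd o (sh o (s - 1)) ≤ fd o y by rw [e1]; have := hco y hy; omega), e1]
      have := hlt y hy; omega
    have := mem_ivl.1 (hUY hmem)
    rw [fd_sh o (show s - 1 < 3 * k + 2 by omega)] at this
    omega

/-- Criterion for a crossing row: a non-empty row with coordinates in `[s, s+k-1]`, one `≤ s+t-1` and one `≥ k`, has its window
inside `X ∪ Y` meeting both. [this work] -/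
theorem mem_Z_of_coords {o : Fin (3 * k + 2)} {s t : ℕ} (hs1 : 1 ≤ s) (hst : s + t ≤ 2 * k + 1)
    {z : Finset (Fin (3 * k + 2))} (hz : z.Nonempty) (hlo : ∀ x ∈ z, s ≤ fd o x) (hhi : ∀ x ∈ z, fd o x ≤ s + k - 1)
    (hmin : ∃ x ∈ z, fd o x ≤ s + t - 1) (hmax : ∃ x ∈ z, k ≤ fd o x) :
    U (k := k) z ⊆ ivl o 0 (s - 1) ∪ ivl o s (s + t - 1) ∧ (U (k := k) z ∩ ivl o 0 (s - 1)).Nonempty ∧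
      (U (k := k) z ∩ ivl o s (s + t - 1)).Nonempty := by
  obtain ⟨x₁, hx₁, hmn⟩ := exists_min_image z (fun x => fd o x) hz
  obtain ⟨x₂, hx₂, hmx⟩ := exists_max_image z (fun x => fd o x) hz
  obtain ⟨xm, hxm, hxm'⟩ := hmin
  obtain ⟨xM, hxM, hxM'⟩ := hmax
  have h1 : fd o x₁ ≤ s + t - 1 := le_trans (hmn xm hxm) hxm'
  have h2 : k ≤ fd o x₂ := le_trans hxM' (hmx xM hxM)
  have h2' := hhi x₂ hx₂
  have h1' := hlo x₁ hx₁
  refine ⟨?_, ?_, ?_⟩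
  · -- every arc containing `z` starts at a coordinate `≤ fd o x₁ ≤ s+t-1`
    intro u hu
    rw [mem_U] at hu
    have hux1 := mem_arc.1 (hu hx₁)
    have hux2 := mem_arc.1 (hu hx₂)
    rw [mem_union, mem_ivl, mem_ivl]
    have := fd_lt o u
    rcases fd_coord_cases o u x₁ with ⟨hc1, e1⟩ | ⟨hc1, e1⟩ <;>
      rcases fd_coord_cases o u x₂ with ⟨hc2, e2⟩ | ⟨hc2, e2⟩ <;> omega
  · -- the arc starting at coordinate `fd o x₂ - k ≤ s-1` contains `z`
    refine ⟨sh o (fd o x₂ - k), mem_inter.2 ⟨?_, ?_⟩⟩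
    · rw [mem_U]; intro y hy; rw [mem_arc]
      have e1 : fd o (sh o (fd o x₂ - k)) = fd o x₂ - k := fd_sh o (by have := fd_lt o x₂; omega)
      have hy1 := hlo y hy; have hy2 := hmx y hy
      rw [fd_sub (show fd o (sh o (fd o x₂ - k)) ≤ fd o y by rw [e1]; omega), e1]; omega
    · rw [mem_ivl, fd_sh o (by have := fd_lt o x₂; omega)]; omega
  · -- the arc starting at `x₁` contains `z`
    refine ⟨x₁, mem_inter.2 ⟨?_, mem_ivl.2 ⟨h1', h1⟩⟩⟩
    rw [mem_U]; intro y hy; rw [mem_arc, fd_sub (hmn y hy)]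
    have := hmx y hy; omega

/-- Criterion for a core row: witnesses `xa` (coordinate `≤ s-1`) and `xv` (coordinate `≥ s+k`) together with either a third point
`xb` with `k ≤ fd o xb ≤ fd o xa + k` or the bound `fd o xv ≤ 2k+1` exclude every arc. [this work] -/
theorem U_eq_empty_of_witnesses {o : Fin (3 * k + 2)} {s : ℕ} (hs1 : 1 ≤ s) {B : Finset (Fin (3 * k + 2))}
    {xa xv : Fin (3 * k + 2)} (ha : xa ∈ B) (ha' : fd o xa ≤ s - 1) (hv : xv ∈ B) (hv' : s + k ≤ fd o xv)
    (h3 : (∃ xb ∈ B, k ≤ fd o xb ∧ fd o xb ≤ fd o xa + k) ∨ fd o xv ≤ 2 * k + 1) : U (k := k) B = ∅ := by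
  rw [← Finset.not_nonempty_iff_eq_empty]
  rintro ⟨u, hu⟩
  rw [mem_U] at hu
  have hua := mem_arc.1 (hu ha)
  have huv := mem_arc.1 (hu hv)
  have hgu := fd_lt o u
  have hxv := fd_lt o xv
  rcases h3 with ⟨xb, hb, hb1, hb2⟩ | h3
  · have hub := mem_arc.1 (hu hb)
    rcases fd_coord_cases o u xa with ⟨hca, ea⟩ | ⟨hca, ea⟩ <;>
      rcases fd_coord_cases o u xv with ⟨hcv, ev⟩ | ⟨hcv, ev⟩ <;>
        rcases fd_coord_cases o u xb with ⟨hcb, eb⟩ | ⟨hcb, eb⟩ <;> omega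
  · rcases fd_coord_cases o u xa with ⟨hca, ea⟩ | ⟨hca, ea⟩ <;>
      rcases fd_coord_cases o u xv with ⟨hcv, ev⟩ | ⟨hcv, ev⟩ <;> omega

/-! ### Row weights as products; pairs of rows with the same multiset have the same weight product -/

/-- The row weight as a product over all points. [this work] -/
theorem wrow_eq_prod (ω : Finset (Fin (3 * k + 2))) :
    wrow p ω = ∏ x, (if x ∈ ω then ((p x : ℝ)) else 1 - (p x : ℝ)) := by
  classical
  unfold wrow TwoGenCore.wmiss
  rw [prod_ite, mul_comm]
  congr 1
  · apply prod_congr _ (fun _ _ => rfl); ext x; simp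
  · apply prod_congr _ (fun _ _ => rfl); ext x; simp

/-- Membership count of a point in a pair of rows. -/
def cnt (S T : Finset (Fin (3 * k + 2))) (x : Fin (3 * k + 2)) : ℕ := (if x ∈ S then 1 else 0) + (if x ∈ T then 1 else 0)

/-- The weight factor of a point as a function of its membership count. -/
def wfac (x : Fin (3 * k + 2)) (n : ℕ) : ℝ :=
  if n = 0 then (1 - (p x : ℝ)) * (1 - (p x : ℝ)) else if n = 1 then (p x : ℝ) * (1 - (p x : ℝ)) else (p x : ℝ) * (p x : ℝ)

/-- The product of the two factors of a point depends only on its membership count. -/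
theorem fac_mul_fac (S T : Finset (Fin (3 * k + 2))) (x : Fin (3 * k + 2)) :
    (if x ∈ S then ((p x : ℝ)) else 1 - (p x : ℝ)) * (if x ∈ T then ((p x : ℝ)) else 1 - (p x : ℝ)) = wfac p x (cnt S T x) := by
  unfold wfac cnt
  by_cases h1 : x ∈ S <;> by_cases h2 : x ∈ T <;> simp [h1, h2]; ring

/-- Pairs of rows with the same membership counts have the same weight product. [this work] -/
theorem wrow_mul_eq_of_cnt {S T B z : Finset (Fin (3 * k + 2))} (h : ∀ x, cnt S T x = cnt B z x) :
    wrow p S * wrow p T = wrow p B * wrow p z := by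
  classical
  rw [wrow_eq_prod, wrow_eq_prod, wrow_eq_prod, wrow_eq_prod, ← prod_mul_distrib, ← prod_mul_distrib]
  refine prod_congr rfl fun x _ => ?_
  rw [fac_mul_fac, fac_mul_fac, h x]

end IML

end Arc

end SafeCalc

end Summit.CriticalPhenomena.PercolationContinuityZ3.Theorems.SunflowerPartition
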